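import Summits.RiemannHypothesis.RiemannHypothesis.Theses.WeilParity
import Summits.RiemannHypothesis.RiemannHypothesis.Theorems.WeilParityEvenWinsBeyondArchSplit

/-!
# `EvenWinsBeyondArch` (crux stmt-RiemannHypothesis-15432, route WeilParity) — the parity-swapped crux is FALSE

Negative lemma from the standing disprover (refuter-cdisprove-stmt-RiemannHypothesis-15432-0, cycle 1).
The crux says `ε_ev(a) ≤ ε_od(a)` for every `a > (log 2)/2` (even sector bottom below the odd one).  Its
PARITY-SWAPPED twin — every EVEN normalised window test is matched up to any `δ > 0` by an ODD one, i.e.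
`ε_od(a) ≤ ε_ev(a)` beyond the archimedean window — is refuted RH-free: the certified anchor
`ε_ev((log 2)/2) < ε_od((log 2)/2)` (`weilEvenGroundEnergy_lt_weilOddGroundEnergy_log_two_half`, p148526, from the
kernel-checked archimedean gap certificate) and the continuity of both sector bottoms at `(log 2)/2`
(`stub_sectorContinuity_continuousAt_even/odd`, p146566, Bombieri 2000 Thm 5 per sector) give a STRICT even win
on an initial segment `((log 2)/2, (log 2)/2 + η)`; there an even near-minimiser below the midpoint of the two
bottoms has no odd match.  So parity is not a symmetric bookkeeping choice in the crux.  Statements inlined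
(no new definitions).  Axioms: propext, Classical.choice, Quot.sound.
-/

noncomputable section

namespace Summit.RiemannHypothesis.RiemannHypothesis.Theorems.EvenWinsBeyondArch.Negative

-- `Summit.RiemannHypothesis.RiemannHypothesis.…` repeats a namespace component by design (D-0017 layout).
set_option linter.dupNamespace false

open Set MeasureTheory Filter
open scoped Topology
open Literature.NumberTheory.LFunctions
open Summit.RiemannHypothesis.RiemannHypothesis.Theorems
open Summit.RiemannHypothesis.RiemannHypothesis.Theorems.EvenWinsBeyondArch

/-- **A strict even win persists near the archimedean window** (RH-free): there is `η > 0` with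
`ε_ev(a) < ε_od(a)` whenever `|a − (log 2)/2| < η` (certified anchor + continuity of both sector bottoms at
`(log 2)/2`). [folklore] -/
theorem exists_strict_order_near_arch :
    ∃ η : ℝ, 0 < η ∧ ∀ a : ℝ, dist a (Real.log 2 / 2) < η →
      weilEvenGroundEnergy a < weilOddGroundEnergy a := by
  have hev : ContinuousAt weilEvenGroundEnergy (Real.log 2 / 2) :=
    stub_sectorContinuity_continuousAt_even log_two_half_pos
  have hod : ContinuousAt weilOddGroundEnergy (Real.log 2 / 2) :=
    stub_sectorContinuity_continuousAt_odd log_two_half_pos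
  have hlt := Filter.Tendsto.eventually_lt hev hod weilEvenGroundEnergy_lt_weilOddGroundEnergy_log_two_half
  obtain ⟨η, hη, h⟩ := Metric.eventually_nhds_iff.1 hlt
  exact ⟨η, hη, fun a ha ↦ h ha⟩

/-- The same for windows beyond `(log 2)/2` only: `ε_ev(a) < ε_od(a)` on `((log 2)/2, (log 2)/2 + η)`. [folklore] -/
theorem exists_strict_order_beyond_arch :
    ∃ η : ℝ, 0 < η ∧ ∀ a : ℝ, Real.log 2 / 2 < a → a < Real.log 2 / 2 + η →
      weilEvenGroundEnergy a < weilOddGroundEnergy a := by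
  obtain ⟨η, hη, h⟩ := exists_strict_order_near_arch
  refine ⟨η, hη, fun a ha1 ha2 ↦ h a ?_⟩
  rw [Real.dist_eq, abs_lt]
  constructor <;> linarith

/-- **At a window with a strict even win the odd sector cannot match the even one**: an even near-minimiser
below the midpoint `(ε_ev + ε_od)/2` is more than `δ = (ε_od − Re Q(e))/2 > 0` below every odd normalised
window test. [folklore] -/
theorem not_oddMatches_of_lt {a : ℝ} (ha : 0 < a) (hlt : weilEvenGroundEnergy a < weilOddGroundEnergy a) :
    ¬ ∀ e : ℝ → ℂ, IsWeilTest e → tsupport e ⊆ Icc (-a) a → (∀ t, e (-t) = e t) →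
        ∫ t, ‖e t‖ ^ 2 = (1 : ℝ) → ∀ δ : ℝ, 0 < δ → ∃ o : ℝ → ℂ, IsWeilTest o ∧
          tsupport o ⊆ Icc (-a) a ∧ (∀ t, o (-t) = -o t) ∧ ∫ t, ‖o t‖ ^ 2 = (1 : ℝ) ∧
            (weilQuadratic o).re ≤ (weilQuadratic e).re + δ := by
  intro h
  have hmid : sInf (weilWindowSphereValues (fun g ↦ ∀ t, g (-t) = g t) a) <
      (weilEvenGroundEnergy a + weilOddGroundEnergy a) / 2 := by
    rw [← weilEvenGroundEnergy_eq_sInf]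
    linarith
  obtain ⟨x, ⟨e, he, hes, hev, hen, rfl⟩, hx⟩ :=
    exists_lt_of_csInf_lt (weilWindowSphereValues_even_nonempty ha) hmid
  set δ : ℝ := (weilOddGroundEnergy a - (weilQuadratic e).re) / 2 with hδ
  have hδpos : 0 < δ := by
    rw [hδ]
    linarith
  obtain ⟨o, ho, hos, hodd, hon, hle⟩ := h e he hes hev hen δ hδpos
  have hod : weilOddGroundEnergy a ≤ (weilQuadratic o).re := weilOddGroundEnergy_le ho hos hodd hon
  rw [hδ] at hle
  linarith

/-- **The parity-swapped crux is FALSE** (RH-free): it is NOT the case that for every `a > (log 2)/2` every even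
normalised Weil test on `[-a, a]` is matched up to any `δ > 0` by an odd one — at `a = (log 2)/2 + η/2` the even
sector wins strictly (`exists_strict_order_beyond_arch`, `not_oddMatches_of_lt`).  Contrast: the crux itself
(even matches odd) is open / RH-strength. [folklore] -/
theorem not_oddWinsBeyondArch :
    ¬ (∀ a : ℝ, Real.log 2 / 2 < a → ∀ e : ℝ → ℂ, IsWeilTest e → tsupport e ⊆ Icc (-a) a →
        (∀ t, e (-t) = e t) → ∫ t, ‖e t‖ ^ 2 = (1 : ℝ) → ∀ δ : ℝ, 0 < δ → ∃ o : ℝ → ℂ, IsWeilTest o ∧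
          tsupport o ⊆ Icc (-a) a ∧ (∀ t, o (-t) = -o t) ∧ ∫ t, ‖o t‖ ^ 2 = (1 : ℝ) ∧
            (weilQuadratic o).re ≤ (weilQuadratic e).re + δ) := by
  intro h
  obtain ⟨η, hη, hst⟩ := exists_strict_order_beyond_arch
  have ha : Real.log 2 / 2 < Real.log 2 / 2 + η / 2 := by linarith
  have ha' : Real.log 2 / 2 + η / 2 < Real.log 2 / 2 + η := by linarith
  exact not_oddMatches_of_lt (log_two_half_pos.trans ha) (hst _ ha ha') (h _ ha)

/-- **Quantified form**: there are a window `a > (log 2)/2`, an EVEN normalised Weil test `e` on it and a slack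
`δ > 0` such that NO odd normalised Weil test on the window comes within `δ` of `Re Q(e)` from above — the even
sector wins with a margin just beyond the archimedean window. [folklore] -/
theorem exists_even_unmatched_beyond_arch :
    ∃ a : ℝ, Real.log 2 / 2 < a ∧ ∃ e : ℝ → ℂ, IsWeilTest e ∧ tsupport e ⊆ Icc (-a) a ∧
      (∀ t, e (-t) = e t) ∧ ∫ t, ‖e t‖ ^ 2 = (1 : ℝ) ∧ ∃ δ : ℝ, 0 < δ ∧
      ∀ o : ℝ → ℂ, IsWeilTest o → tsupport o ⊆ Icc (-a) a → (∀ t, o (-t) = -o t) →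
        ∫ t, ‖o t‖ ^ 2 = (1 : ℝ) → (weilQuadratic e).re + δ < (weilQuadratic o).re := by
  obtain ⟨η, hη, hst⟩ := exists_strict_order_beyond_arch
  set a : ℝ := Real.log 2 / 2 + η / 2 with ha_def
  have ha : Real.log 2 / 2 < a := by rw [ha_def]; linarith
  have ha' : a < Real.log 2 / 2 + η := by rw [ha_def]; linarith
  have ha0 : 0 < a := log_two_half_pos.trans ha
  have hlt := hst a ha ha'
  have hmid : sInf (weilWindowSphereValues (fun g ↦ ∀ t, g (-t) = g t) a) <
      (weilEvenGroundEnergy a + weilOddGroundEnergy a) / 2 := by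
    rw [← weilEvenGroundEnergy_eq_sInf]
    linarith
  obtain ⟨x, ⟨e, he, hes, hev, hen, rfl⟩, hx⟩ :=
    exists_lt_of_csInf_lt (weilWindowSphereValues_even_nonempty ha0) hmid
  refine ⟨a, ha, e, he, hes, hev, hen, (weilOddGroundEnergy a - (weilQuadratic e).re) / 2, by linarith,
    fun o ho hos hodd hon ↦ ?_⟩
  have hod : weilOddGroundEnergy a ≤ (weilQuadratic o).re := weilOddGroundEnergy_le ho hos hodd hon
  linarith

end Summit.RiemannHypothesis.RiemannHypothesis.Theorems.EvenWinsBeyondArch.Negative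

end
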